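import Literature.NumberTheory.IwasawaTheory.ClassicalMuVanishesBoundedRankAlgebra
import Mathlib.RingTheory.Nilpotent.Basic
import Mathlib.Algebra.Polynomial.Div
import HarnessLib

/-!
# Nakayama over `ℤ[φ]` acting on a finite abelian `p`-group (`φ^{p^t} = 1`): polynomials in `φ` with `p ∤ f(1)` act INVERTIBLY, and
# `N ⊆ S + pN + (φ−1)N ⟹ N ⊆ S` for `φ`-stable subgroups — the plumbing of the elementary-layer lemma

Topic `NumberTheory/IwasawaTheory` (namespace `Literature.NumberTheory.IwasawaTheory.FukudaElementary`).  THEOREM-ONLY file (no definition,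
no named fact, no instance, no `sorry`), written by the prover seat `bsd-line-att-p3` g47 (cell `bsd-f1-sign2`, route `AlignedTransportAtTwo`;
`--supports` stmt-BirchSwinnertonDyer-22298, closes nothing; BSD is not advanced by this file).  First of three algebra bricks
(`FukudaElementaryLayerNakayama` → `FukudaElementaryLayerGenerator` → `FukudaElementaryLayerAlgebra`) behind the door `ClassGroupPRankLeOfNotElementaryLayer`.

THE SETTING.  `M` a finite abelian group of `p`-power order, `φ ∈ End_ℤ(M)` with `φ^{p^t} = 1`, `T = φ − 1`, `ν_j = ∑_{i<p^j} φ^i`, `pM`, `𝔪M = pM + TM`.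
The commutative ring `ℤ[φ]` acts on `M` and `𝔪 = (p, T)` is nilpotent on it (`T^{p^t}M ⊆ pM`, tree `MuZeroRank.pow_prime_pow_apply_mem_of_pow_eq_one`) —
the finite shadow of «`Λ = ℤ_p⟦T⟧` is local with maximal ideal `(p, T)`» (Washington §13.2).

* §1 polynomial identities: `ν_j = (X−1)^{p^j−1} + p·R_j` with **`R_j(1) = p^{j−1}`** (the tree's congruence plus the value of the error term at `X = 1`),
  `f = f(1) + (X − 1)·g`;
* §2 `isUnit_aeval_of_not_dvd_eval` — **`f(φ)` is a unit of `End(M)` when `p ∤ f(1)`** (`f(1)·1` is invertible modulo `p^a = #M`, `T·g(φ)` is nilpotent);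
  stability plumbing (`pM` is stable under every endomorphism; endomorphisms commuting with `θ` preserve `θ(N)`); the iteration
  `le_sup_map_pow_of_le_sup_map` and **NAKAYAMA** `le_of_le_sup_smul_sup_sub_one`: `N ⊆ S + pN + TN ⟹ N ⊆ S` for `φ`-stable `N`, `S`.

References: [Washington1997] L. Washington, *Introduction to Cyclotomic Fields*, 2nd ed., §13.2 Lemma 13.16 (Nakayama), §13.3 Prop. 13.23 (proof);
[Fukuda1994] T. Fukuda, *Remarks on ℤ_p-extensions of number fields*, Proc. Japan Acad. 70 A (1994), Thm. 1 and its proof, p. 264;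
[Lang1990] S. Lang, *Cyclotomic Fields I and II*, Ch. 5 §1–§2.
-/

set_option autoImplicit false

noncomputable section

open Polynomial Finset

namespace Literature.NumberTheory.IwasawaTheory.FukudaElementary

/-! ## §1 Polynomial identities -/

/-- **`∑_{i<p^j} X^i = (X − 1)^{p^j−1} + p·R` with `R(1) = p^{j−1}`** (`j ≥ 1`): the tree's congruence `ν_j ≡ T^{p^j−1} (mod p)` together with the
VALUE of the error term at `X = 1` (evaluate: `p^j = 0 + p·R(1)`). [cite: Washington1997, §13.3 Prop. 13.23 (proof: `ν_n ≡ T^{p^n−1} mod p`)] -/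
theorem exists_geom_sum_eq_X_sub_one_pow_add_C_mul (p j : ℕ) [hp : Fact p.Prime] (hj : 1 ≤ j) :
    ∃ R : ℤ[X], (∑ i ∈ range (p ^ j), (X : ℤ[X]) ^ i) = (X - 1) ^ (p ^ j - 1) + C (p : ℤ) * R ∧
      R.eval 1 = (p : ℤ) ^ (j - 1) := by
  obtain ⟨R, hR⟩ := MuZeroRank.exists_geom_sum_eq_X_sub_one_pow_add p j
  refine ⟨R, hR, ?_⟩
  have hne : p ^ j - 1 ≠ 0 := Nat.sub_ne_zero_of_lt (Nat.one_lt_pow (by omega) hp.out.one_lt)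
  have h := congrArg (Polynomial.eval (1 : ℤ)) hR
  rw [eval_finsetSum, eval_add, eval_mul, eval_C, eval_pow, eval_sub, eval_X, eval_one, sub_self, zero_pow hne,
    zero_add] at h
  simp only [eval_pow, eval_X, one_pow, sum_const, card_range] at h
  -- `h : ↑(p ^ j) = ↑p * eval 1 R`
  have hp0 : (p : ℤ) ≠ 0 := by exact_mod_cast hp.out.ne_zero
  obtain ⟨j', rfl⟩ : ∃ j', j = j' + 1 := ⟨j - 1, by omega⟩
  rw [Nat.add_sub_cancel]
  apply mul_left_cancel₀ hp0
  rw [← h]; ring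

/-- **`f = f(1) + (X − 1)·g`** in `ℤ[X]` (division by `X − 1`; the expansion in powers of `T = X − 1` used throughout Washington §13 / Lang Ch. 5).
[cite: Lang1990, Ch. 5 §2 (Weierstrass preparation: power series in `T`)] -/
theorem exists_eq_C_eval_add_X_sub_one_mul (f : ℤ[X]) : ∃ g : ℤ[X], f = C (f.eval 1) + (X - 1) * g := by
  obtain ⟨g, hg⟩ := (X_sub_C_dvd_sub_C_eval : X - C (1 : ℤ) ∣ f - C (f.eval 1))
  refine ⟨g, ?_⟩
  rw [C_1] at hg
  linear_combination hg

/-! ## §2 `ℤ[φ]` acting on a finite abelian `p`-group: units, stability, Nakayama -/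

section Module

variable {M : Type*} [AddCommGroup M] {p : ℕ}

/-- `p^a · M = 0` when `#M = p^a` (finite `ℤ_p`-modules). [cite: Lang1990, Ch. 5 §1 (finite `Λ`-modules, `e_n(V)`)] -/
theorem exists_pow_smul_eq_zero [Finite M] (hM : ∃ a : ℕ, Nat.card M = p ^ a) : ∃ a : ℕ, ∀ x : M, ((p : ℤ) ^ a) • x = 0 := by
  obtain ⟨a, ha⟩ := hM
  refine ⟨a, fun x => ?_⟩
  rw [← Nat.cast_pow, natCast_zsmul, ← ha]
  exact card_nsmul_eq_zero'

/-- Polynomials in `φ` commute with each other. [folklore] -/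
private theorem commute_aeval_aeval (φ : Module.End ℤ M) (f g : ℤ[X]) : Commute (aeval φ f) (aeval φ g) :=
  (Commute.all f g).map (aeval φ : ℤ[X] →ₐ[ℤ] Module.End ℤ M)

/-- An endomorphism commuting with `φ` commutes with every `f(φ)` (the commutative ring `ℤ[φ]`, finite shadow of `Λ = ℤ_p⟦T⟧`).
[cite: Washington1997, §13.2 (the Iwasawa algebra `Λ = ℤ_p⟦T⟧`, `T = γ − 1`)] -/
theorem commute_aeval_of_commute {ψ φ : Module.End ℤ M} (h : Commute ψ φ) (f : ℤ[X]) : Commute ψ (aeval φ f) := by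
  refine Polynomial.induction_on' f (fun f g hf hg => ?_) (fun n c => ?_)
  · rw [map_add]; exact hf.add_right hg
  · rw [aeval_monomial, algebraMap_int_eq, eq_intCast]
    exact (Int.cast_commute c ψ).symm.mul_right (h.pow_right n)

/-- `aeval φ (X − 1) = φ − 1` (`T = γ − 1`). [cite: Washington1997, §13.2 (`T = γ − 1`)] -/
theorem aeval_X_sub_one (φ : Module.End ℤ M) : aeval φ (X - 1 : ℤ[X]) = φ - 1 := by
  rw [map_sub, aeval_X, map_one]

/-- `T = φ − 1` commutes with `φ`. [cite: Washington1997, §13.2 (`T = γ − 1`)] -/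
theorem commute_sub_one_self (φ : Module.End ℤ M) : Commute (φ - 1) φ :=
  (Commute.refl φ).sub_left (Commute.one_left φ)

/-- **`(φ − 1)^{p^t} = p·E(φ)`** for some polynomial `E`, when `φ^{p^t} = 1`: `(X + 1)^{p^t} = X^{p^t} + 1 + p·R(X)` at `X = φ − 1`.
[cite: Washington1997, §13.3 Lemma 13.16 (proof)] -/
theorem exists_sub_one_pow_eq_smul_aeval [hp : Fact p.Prime] (φ : Module.End ℤ M) {t : ℕ} (hφ : φ ^ p ^ t = 1) :
    ∃ E : ℤ[X], (φ - 1) ^ p ^ t = (p : ℤ) • aeval φ E := by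
  obtain ⟨R, hR⟩ := FukudaNakayama.exists_X_add_one_pow_prime_pow_eq p t
  have h := congrArg (aeval (φ - 1)) hR
  rw [map_pow, map_add, aeval_X, map_one, sub_add_cancel, hφ, map_add, map_add, map_pow, aeval_X, map_one, map_mul,
    aeval_C, algebraMap_int_eq, eq_intCast] at h
  have h0 : (φ - 1) ^ (p ^ t) + ((p : ℤ) : Module.End ℤ M) * aeval (φ - 1) R = 0 := by
    have h1 : (0 : Module.End ℤ M) + 1 = ((φ - 1) ^ (p ^ t) + ((p : ℤ) : Module.End ℤ M) * aeval (φ - 1) R) + 1 := by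
      rw [zero_add, add_right_comm]; exact h
    exact (add_right_cancel h1).symm
  have h' : (φ - 1) ^ (p ^ t) = -(((p : ℤ) : Module.End ℤ M) * aeval (φ - 1) R) := eq_neg_of_add_eq_zero_left h0
  refine ⟨-(R.comp (X - 1)), ?_⟩
  rw [h', map_neg, smul_neg, aeval_comp, aeval_X_sub_one, ← zsmul_eq_mul]

/-- **`f(φ)` is a UNIT of `End(M)` when `p ∤ f(1)`**: `f(φ) = f(1) + T·g(φ)` with `f(1)` invertible modulo `p^a = #M` and `T·g(φ)` nilpotent
(`T^{p^t} = p·E(φ)`, `p^a M = 0`) — the finite shadow of «`Λ` is local with maximal ideal `(p, T)`». [cite: Washington1997, §13.2 Lemma 13.16] -/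
theorem isUnit_aeval_of_not_dvd_eval [Finite M] [hp : Fact p.Prime] (hM : ∃ a : ℕ, Nat.card M = p ^ a) (φ : Module.End ℤ M) {t : ℕ}
    (hφ : φ ^ p ^ t = 1) {f : ℤ[X]} (hf : ¬ (p : ℤ) ∣ f.eval 1) : IsUnit (aeval φ f) := by
  obtain ⟨a, ha⟩ := exists_pow_smul_eq_zero hM
  obtain ⟨g, hg⟩ := exists_eq_C_eval_add_X_sub_one_mul f
  obtain ⟨E, hE⟩ := exists_sub_one_pow_eq_smul_aeval φ hφ
  set c : ℤ := f.eval 1 with hc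
  -- `p^a • 1 = 0` on `M`
  have hpa : ((p : ℤ) ^ a) • (1 : Module.End ℤ M) = 0 := by
    ext x; rw [LinearMap.smul_apply, Module.End.one_apply, LinearMap.zero_apply]; exact ha x
  -- the constant part is a unit
  have hcop : IsCoprime ((p : ℤ) ^ a) c :=
    (((Nat.prime_iff_prime_int.mp hp.out).irreducible.coprime_iff_not_dvd).mpr hf).pow_left
  obtain ⟨u, v, huv⟩ := hcop
  have hvc : v * c = 1 - u * (p : ℤ) ^ a := by linear_combination huv
  have hunit : IsUnit (c • (1 : Module.End ℤ M)) := by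
    have hinv : (v • (1 : Module.End ℤ M)) * (c • (1 : Module.End ℤ M)) = 1 := by
      rw [smul_mul_assoc, one_mul, smul_smul, hvc, sub_smul, one_smul, mul_smul, hpa, smul_zero, sub_zero]
    have hinv' : (c • (1 : Module.End ℤ M)) * (v • (1 : Module.End ℤ M)) = 1 := by
      rw [smul_mul_assoc, one_mul, smul_smul, mul_comm c v, hvc, sub_smul, one_smul, mul_smul, hpa, smul_zero, sub_zero]
    exact ⟨⟨c • 1, v • 1, hinv', hinv⟩, rfl⟩
  -- the rest is nilpotent
  have hcomm : Commute (φ - 1) (aeval φ g) := by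
    rw [← aeval_X_sub_one]; exact commute_aeval_aeval φ _ _
  have hkill : ∀ Z : Module.End ℤ M, ((p : ℤ) ^ a) • Z = 0 := fun Z => by
    ext x; rw [LinearMap.smul_apply, LinearMap.zero_apply]; exact ha _
  have hnil : IsNilpotent ((φ - 1) * aeval φ g) := by
    refine ⟨p ^ t * a, ?_⟩
    rw [pow_mul, hcomm.mul_pow, hE, smul_mul_assoc, _root_.smul_pow, hkill]
  have hcomm2 : Commute ((φ - 1) * aeval φ g) (c • (1 : Module.End ℤ M)) :=
    (Commute.one_right _).smul_right c
  have hf' : aeval φ f = c • (1 : Module.End ℤ M) + (φ - 1) * aeval φ g := by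
    conv_lhs => rw [hg]
    rw [map_add, map_mul, aeval_C, algebraMap_int_eq, eq_intCast, aeval_X_sub_one, zsmul_one]
  rw [hf']
  exact hnil.isUnit_add_left_of_commute hunit hcomm2

/-- `pM` is stable under EVERY endomorphism (a `Λ`-submodule). [cite: Washington1997, §13.3 Lemma 13.15 (proof: `Λ`-submodules of `X`)] -/
theorem apply_mem_map_top_smul (ψ : Module.End ℤ M) {w : M}
    (hw : w ∈ (⊤ : Submodule ℤ M).map ((p : ℤ) • (1 : Module.End ℤ M))) :
    ψ w ∈ (⊤ : Submodule ℤ M).map ((p : ℤ) • (1 : Module.End ℤ M)) := by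
  obtain ⟨z, -, rfl⟩ := Submodule.mem_map.mp hw
  refine Submodule.mem_map.mpr ⟨ψ z, Submodule.mem_top, ?_⟩
  rw [LinearMap.smul_apply, LinearMap.smul_apply, Module.End.one_apply, Module.End.one_apply, map_zsmul]

/-- An endomorphism commuting with `θ` maps `θ(N)` into `θ(N)` as soon as it maps `N` into `N` (`Λ`-submodules).
[cite: Washington1997, §13.3 Lemma 13.15 (proof: `Λ`-submodules of `X`)] -/
theorem apply_mem_map_of_commute {ψ θ : Module.End ℤ M} (h : Commute ψ θ) {N : Submodule ℤ M}
    (hN : ∀ x ∈ N, ψ x ∈ N) {w : M} (hw : w ∈ N.map θ) : ψ w ∈ N.map θ := by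
  obtain ⟨z, hz, rfl⟩ := Submodule.mem_map.mp hw
  refine Submodule.mem_map.mpr ⟨ψ z, hN z hz, ?_⟩
  rw [← Module.End.mul_apply, ← h.eq, Module.End.mul_apply]

/-- An endomorphism commuting with `θ` maps `θ(M)` into `θ(M)` (`Λ`-submodules). [cite: Washington1997, §13.3 Lemma 13.15 (proof)] -/
theorem apply_mem_map_top_of_commute {ψ θ : Module.End ℤ M} (h : Commute ψ θ) {w : M}
    (hw : w ∈ (⊤ : Submodule ℤ M).map θ) : ψ w ∈ (⊤ : Submodule ℤ M).map θ :=
  apply_mem_map_of_commute h (fun _ _ => Submodule.mem_top) hw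

/-- A `φ`-stable subgroup is stable under every polynomial in `φ` (re-proved: private in `FukudaNakayamaFinite`). [folklore] -/
private theorem aeval_apply_mem_of_forall_mem (φ : Module.End ℤ M) (Y : Submodule ℤ M)
    (hY : ∀ y ∈ Y, φ y ∈ Y) (q : ℤ[X]) {y : M} (hy : y ∈ Y) : aeval φ q y ∈ Y := by
  induction q using Polynomial.induction_on' with
  | add q r hq hr => rw [map_add, LinearMap.add_apply]; exact Y.add_mem hq hr
  | monomial n a =>
    rw [← C_mul_X_pow_eq_monomial, map_mul, map_pow, aeval_C, aeval_X, Module.End.mul_apply, algebraMap_int_eq,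
      eq_intCast, Module.End.intCast_apply]
    refine Y.smul_mem _ ?_
    induction n with
    | zero => simpa using hy
    | succ n ih => rw [pow_succ', Module.End.mul_apply]; exact hY _ ih

/-- A `φ`-stable subgroup is `(φ − 1)`-stable. [folklore] -/
private theorem sub_one_apply_mem {φ : Module.End ℤ M} {N : Submodule ℤ M} (hN : ∀ x ∈ N, φ x ∈ N) {x : M} (hx : x ∈ N) :
    (φ - 1) x ∈ N := by
  rw [LinearMap.sub_apply, Module.End.one_apply]; exact N.sub_mem (hN x hx) hx

/-- ITERATION: `ψ(S) ⊆ S` and `N ⊆ S + ψ(N)` give `N ⊆ S + ψ^r(N)` for every `r`. [cite: Washington1997, §13.2 Lemma 13.16 (Nakayama)] -/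
private theorem le_sup_map_pow_of_le_sup_map {ψ : Module.End ℤ M} {N S : Submodule ℤ M} (hS : S.map ψ ≤ S)
    (h : N ≤ S ⊔ N.map ψ) (r : ℕ) : N ≤ S ⊔ N.map (ψ ^ r) := by
  have hSr : ∀ i : ℕ, S.map (ψ ^ i) ≤ S := by
    intro i
    induction i with
    | zero => rw [pow_zero, Module.End.one_eq_id, Submodule.map_id]
    | succ i ih => rw [pow_succ', Module.End.mul_eq_comp, Submodule.map_comp]; exact (Submodule.map_mono ih).trans hS
  induction r with
  | zero => rw [pow_zero, Module.End.one_eq_id, Submodule.map_id]; exact le_sup_right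
  | succ r ih =>
    calc N ≤ S ⊔ N.map (ψ ^ r) := ih
      _ ≤ S ⊔ (S ⊔ N.map ψ).map (ψ ^ r) := sup_le_sup_left (Submodule.map_mono h) _
      _ = S ⊔ (S.map (ψ ^ r) ⊔ N.map (ψ ^ (r + 1))) := by
          rw [Submodule.map_sup, pow_succ, Module.End.mul_eq_comp, Submodule.map_comp]
      _ ≤ S ⊔ N.map (ψ ^ (r + 1)) := sup_le le_sup_left (sup_le (le_sup_of_le_left (hSr r)) le_sup_right)

/-- **NAKAYAMA for `ℤ[φ]` acting on a finite abelian `p`-group** (`φ^{p^t} = 1`): for `φ`-stable subgroups `N`, `S` of `M`,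
**`N ⊆ S + pN + (φ−1)N ⟹ N ⊆ S`** — iterate along `T = φ − 1` (the subgroup `S + pN` is `T`-stable and `T^{p^t}N ⊆ pN`), then along `p` (`p^a N = 0`).
[cite: Washington1997, §13.2 Lemma 13.16] [cite: Fukuda1994, Thm. 1 (proof, p. 264)] -/
theorem le_of_le_sup_smul_sup_sub_one [Finite M] [hp : Fact p.Prime] (hM : ∃ a : ℕ, Nat.card M = p ^ a) (φ : Module.End ℤ M)
    {t : ℕ} (hφ : φ ^ p ^ t = 1) {N S : Submodule ℤ M} (hN : ∀ x ∈ N, φ x ∈ N) (hS : ∀ x ∈ S, φ x ∈ S)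
    (h : N ≤ S ⊔ (N.map ((p : ℤ) • (1 : Module.End ℤ M)) ⊔ N.map (φ - 1))) : N ≤ S := by
  obtain ⟨a, ha⟩ := exists_pow_smul_eq_zero hM
  obtain ⟨E, hE⟩ := exists_sub_one_pow_eq_smul_aeval φ hφ
  set π : Module.End ℤ M := (p : ℤ) • 1 with hπ
  set T : Module.End ℤ M := φ - 1 with hT
  -- `S + pN` is `T`-stable
  have hS1 : (S ⊔ N.map π).map T ≤ S ⊔ N.map π := by
    rw [Submodule.map_sup]
    refine sup_le_sup ?_ ?_
    · rintro _ ⟨s, hs, rfl⟩; exact sub_one_apply_mem hS hs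
    · rintro _ ⟨_, ⟨n, hn, rfl⟩, rfl⟩
      refine ⟨T n, sub_one_apply_mem hN hn, ?_⟩
      rw [hπ, LinearMap.smul_apply, LinearMap.smul_apply, Module.End.one_apply, Module.End.one_apply, map_zsmul]
  have h1 : N ≤ (S ⊔ N.map π) ⊔ N.map T := by rwa [sup_assoc]
  have h2 := le_sup_map_pow_of_le_sup_map hS1 h1 (p ^ t)
  -- `T^{p^t} N ⊆ pN`
  have h3 : N.map (T ^ p ^ t) ≤ N.map π := by
    rintro _ ⟨x, hx, rfl⟩
    refine ⟨aeval φ E x, aeval_apply_mem_of_forall_mem φ N hN E hx, ?_⟩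
    rw [hT, hE, hπ, LinearMap.smul_apply, LinearMap.smul_apply, Module.End.one_apply]
  have h4 : N ≤ S ⊔ N.map π := h2.trans (sup_le le_rfl (h3.trans le_sup_right))
  -- iterate along `p`
  have hSπ : S.map π ≤ S := by
    rintro _ ⟨s, hs, rfl⟩; rw [hπ, LinearMap.smul_apply, Module.End.one_apply]; exact S.smul_mem _ hs
  have h5 := le_sup_map_pow_of_le_sup_map hSπ h4 a
  have h6 : N.map (π ^ a) = ⊥ := by
    rw [eq_bot_iff]
    rintro _ ⟨x, -, rfl⟩
    rw [Submodule.mem_bot, hπ, _root_.smul_pow, one_pow, LinearMap.smul_apply, Module.End.one_apply]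
    exact ha x
  rw [h6, sup_bot_eq] at h5
  exact h5

end Module

end Literature.NumberTheory.IwasawaTheory.FukudaElementary

end
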